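import Literature.Algebra.Polynomial.ShefferSequences
import Mathlib.Tactic
import HarnessLib

/-!
# The Laguerre operator `D/(D − I)`, the basic Laguerre polynomials and the Laguerre polynomials
# of integral order (Rota–Kahaner–Odlyzko §11)

G.-C. Rota, D. Kahaner, A. Odlyzko, *Finite operator calculus* (1973), §11 "Laguerre polynomials",
pp. 727–728:

> … polynomials of Laguerre type, which are the Sheffer sets relative to the delta operator
> `K f (x) = −∫_0^∞ e^{−t} f' (x + t) dt`, called the Laguerre operator. From the first expansion
> theorem we have `K = Σ a_n D^n/n!`, `a_n = −(n−1)!`, so that `K = −D − D² − ⋯ = D/(D − I)`.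
> The basic polynomials of the Laguerre operator are easily computed from Theorem 4, formula (3):
> (*) `L_n (x) = x (D − I)^n x^{n−1}`, called the basic Laguerre polynomials. … From formula (*)
> we find by binomial expansion that `L_n (x) = Σ_{k ≥ 1} n!/k! · C(n−1, k−1) (−x)^k`, where the
> coefficients `n!/k! · C(n−1, k−1)` are known as the (signless) Lah numbers.
> We shall be concerned with Laguerre type sets relative to the operators `(I − D)^{α+1}`. … The
> Sheffer sets relative to these operators are polynomial sets `L_n^{(α)} (x)`, classically known as
> Laguerre polynomials of order `α`. (Note that our definition of Laguerre polynomials differs from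
> that used by many authors by a factor of `n!`.) … `L_n^{(α)} (x) = (I − D)^{α+1} L_n (x)`,
> `(I − D)^{β} L_n^{(α)} (x) = L_n^{(α+β)} (x)`. … Using the Pincherle derivative identity
> `(D − I)^n x − x (D − I)^n = ((D − I)^n)' = n (D − I)^{n−1}` … `L_n^{(α)} (x) = (−1)^n
> (I − D)^{α+n} x^n = (−1)^n Σ_k (−1)^k C(α+n, k) D^k x^n`.

Here the Laguerre operator is taken through its indicator `t/(t − 1) = −t − t² − ⋯` (an algebraic
substitute for the integral, over any field of characteristic `0`): `K = D ∘ φ(D)` with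
`φ = (t − 1)^{−1}` (constant term `−1 ≠ 0`), so that the transfer formula of
`BasicSequenceClosedForms` applies verbatim with `φ^{−n} = (t − 1)^n`. The order `α` is restricted
to integers `α = m − 1 ≥ −1` (`(I − D)^{m}` with `m : ℕ`).
-- TODO(general form): real order `α > −1` needs the binomial series `(1 − t)^{α+1} ∈ K[[t]]`.

Definitions (with bodies): `laguerreOperator K = D ∘ (t − 1)^{−1}(D)`; `laguerreBasic K n` — its
basic sequence `L_n`; `laguerreSheffer K m n = (I − D)^m L_n` — the Laguerre polynomials of order
`m − 1` in the normalisation of Rota–Kahaner–Odlyzko (`= n! ×` the classical `L_n^{(m−1)}`).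

## References
* [RotaKahanerOdlyzko1973] G.-C. Rota, D. Kahaner, A. Odlyzko, *On the foundations of
  combinatorial theory VIII. Finite operator calculus*, J. Math. Anal. Appl. 42 (1973) 684–760,
  §11, pp. 727–729 (and §4 Theorem 4, Proposition 2, pp. 695–696).
* [Robert2000PadicAnalysis] A. M. Robert, *A Course in p-adic Analysis*, GTM 198, Springer (2000),
  Ch. IV §5.5 Lemma and Proposition (Pincherle derivative, transfer formula), p. 203.
-/

noncomputable section

open Polynomial Finset

namespace Literature.Algebra.Polynomial

variable (K : Type*) [Field K]

/-! ## The indicator `t/(t − 1) = −t − t² − ⋯` of the Laguerre operator -/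

/-- The constant term of `t − 1` is `−1`. [cite: RotaKahanerOdlyzko1973, §11, p. 727] -/
theorem constantCoeff_X_sub_one :
    PowerSeries.constantCoeff (PowerSeries.X - 1 : PowerSeries K) = -1 := by
  rw [map_sub, PowerSeries.constantCoeff_X, map_one, zero_sub]

/-- `t − 1` is invertible in `K[[t]]` (constant term `−1 ≠ 0`).
[cite: RotaKahanerOdlyzko1973, §11, p. 727] -/
theorem constantCoeff_X_sub_one_ne_zero :
    PowerSeries.constantCoeff (PowerSeries.X - 1 : PowerSeries K) ≠ 0 := by
  rw [constantCoeff_X_sub_one]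
  exact neg_ne_zero.2 one_ne_zero

/-- `(t − 1)^{−1} = −(1 + t + t² + ⋯)` ("`K = −D − D² − ⋯`").
[cite: RotaKahanerOdlyzko1973, §11, p. 727] -/
theorem X_sub_one_inv : (PowerSeries.X - 1 : PowerSeries K)⁻¹ = -PowerSeries.mk 1 := by
  rw [PowerSeries.inv_eq_iff_mul_eq_one (constantCoeff_X_sub_one_ne_zero K), neg_mul, mul_sub,
    mul_one, neg_sub, PowerSeries.ext_iff]
  intro n
  rw [map_sub, PowerSeries.coeff_one]
  cases n with
  | zero =>
    rw [PowerSeries.coeff_zero_mul_X, PowerSeries.coeff_mk, Pi.one_apply, sub_zero, if_pos rfl]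
  | succ n =>
    rw [PowerSeries.coeff_succ_mul_X, PowerSeries.coeff_mk, PowerSeries.coeff_mk, Pi.one_apply,
      Pi.one_apply, sub_self, if_neg (Nat.succ_ne_zero n)]

/-- `φ = (t − 1)^{−1}` has constant term `−1 ≠ 0`, so `D φ(D)` is a delta operator and the transfer
formula applies. [cite: RotaKahanerOdlyzko1973, §11, p. 727]
[cite: Robert2000PadicAnalysis, Ch. IV §5.5 Proposition, p. 203] -/
theorem constantCoeff_X_sub_one_inv_ne_zero :
    PowerSeries.constantCoeff ((PowerSeries.X - 1 : PowerSeries K)⁻¹) ≠ 0 := by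
  rw [PowerSeries.constantCoeff_inv, constantCoeff_X_sub_one]
  norm_num

/-- `((t − 1)^{−1})^{−1} = t − 1`, i.e. `φ^{−n} = (t − 1)^n` in the transfer formula.
[cite: RotaKahanerOdlyzko1973, §11 (*), p. 727] -/
theorem X_sub_one_inv_inv : ((PowerSeries.X - 1 : PowerSeries K)⁻¹)⁻¹ = PowerSeries.X - 1 := by
  rw [PowerSeries.inv_eq_iff_mul_eq_one (constantCoeff_X_sub_one_inv_ne_zero K),
    PowerSeries.mul_inv_cancel _ (constantCoeff_X_sub_one_ne_zero K)]

/-- **The indicator of the Laguerre operator**: `t · (t − 1)^{−1} = −t − t² − t³ − ⋯`, i.e.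
"`K = Σ_{n ≥ 1} a_n D^n/n!` with `a_n = −(n−1)!`, so that `K = −D − D² − ⋯ = D/(D − I)`".
[cite: RotaKahanerOdlyzko1973, §11, p. 727] -/
theorem coeff_X_mul_X_sub_one_inv (n : ℕ) :
    PowerSeries.coeff n (PowerSeries.X * (PowerSeries.X - 1 : PowerSeries K)⁻¹) =
      if n = 0 then 0 else -1 := by
  rw [X_sub_one_inv, mul_neg, map_neg]
  cases n with
  | zero => rw [PowerSeries.coeff_zero_X_mul, neg_zero, if_pos rfl]
  | succ n =>
    rw [PowerSeries.coeff_succ_X_mul, PowerSeries.coeff_mk, Pi.one_apply, if_neg (Nat.succ_ne_zero n)]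

/-- The binomial expansion of `(t − 1)^n`: the coefficient of `t^k` is `(−1)^{n−k} C(n, k)`.
[cite: RotaKahanerOdlyzko1973, §11 ("from formula (*) we find by binomial expansion"), p. 727] -/
theorem powerSeries_coeff_X_sub_one_pow (n k : ℕ) :
    PowerSeries.coeff k ((PowerSeries.X - 1 : PowerSeries K) ^ n) =
      (-1 : K) ^ (n - k) * (n.choose k : K) := by
  have h : (PowerSeries.X - 1 : PowerSeries K) ^ n =
      (((X + C (-1 : K)) ^ n : K[X]) : PowerSeries K) := by
    rw [Polynomial.coe_pow, C_neg, C_1, ← sub_eq_add_neg, Polynomial.coe_sub, Polynomial.coe_X,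
      Polynomial.coe_one]
  rw [h, Polynomial.coeff_coe, coeff_X_add_C_pow]

/-- The binomial expansion of `(1 − t)^m`: the coefficient of `t^k` is `(−1)^k C(m, k)`
("`(I − D)^{α+n} x^n = Σ_k (−1)^k C(α+n, k) D^k x^n`"). [cite: RotaKahanerOdlyzko1973, §11, p. 728] -/
theorem powerSeries_coeff_one_sub_X_pow (m k : ℕ) :
    PowerSeries.coeff k ((1 - PowerSeries.X : PowerSeries K) ^ m) = (-1 : K) ^ k * (m.choose k : K) := by
  have h1 : (-1 : PowerSeries K) ^ m = PowerSeries.C ((-1 : K) ^ m) := by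
    rw [map_pow, map_neg, map_one]
  rw [← neg_sub, neg_pow, h1, PowerSeries.coeff_C_mul, powerSeries_coeff_X_sub_one_pow]
  rcases le_or_gt k m with hkm | hkm
  · rw [← mul_assoc, ← pow_add, show m + (m - k) = k + 2 * (m - k) by omega, pow_add, pow_mul,
      neg_one_sq, one_pow, mul_one]
  · rw [Nat.choose_eq_zero_of_lt hkm, Nat.cast_zero, mul_zero, mul_zero, mul_zero]

/-- `(I − D)^j 1 = 1` (the operators `(I − D)^{α+1}` are invertible and fix constants).
[cite: RotaKahanerOdlyzko1973, §11, p. 728] -/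
theorem diffOp_one_sub_X_pow_apply_one (j : ℕ) :
    diffOp ((1 - PowerSeries.X : PowerSeries K) ^ j) (1 : K[X]) = 1 := by
  rw [diffOp_apply_one, map_pow, map_sub, map_one, PowerSeries.constantCoeff_X, sub_zero, one_pow, C_1]

/-! ## The Laguerre operator `K = D/(D − I)` -/

/-- **The Laguerre operator** `K = D/(D − I) = −D − D² − ⋯` (Rota–Kahaner–Odlyzko:
`K f (x) = −∫_0^∞ e^{−t} f' (x + t) dt`; here defined through its indicator `t (t − 1)^{−1}`, as the
delta operator `D ∘ φ(D)` with `φ = (t − 1)^{−1}`). [cite: RotaKahanerOdlyzko1973, §11, p. 727] -/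
def laguerreOperator : K[X] →ₗ[K] K[X] :=
  derivative ∘ₗ diffOp ((PowerSeries.X - 1 : PowerSeries K)⁻¹)

/-- Unfolding `K = D ∘ (t − 1)^{−1} (D)`. [cite: RotaKahanerOdlyzko1973, §11, p. 727] -/
theorem laguerreOperator_eq :
    laguerreOperator K = derivative ∘ₗ diffOp ((PowerSeries.X - 1 : PowerSeries K)⁻¹) :=
  rfl

variable {K} in
/-- **The Pincherle derivative identity** for `(D − I)^{m+1}`:
`(D − I)^{m+1} x − x (D − I)^{m+1} = ((D − I)^{m+1})' = (m+1) (D − I)^m`.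
[cite: RotaKahanerOdlyzko1973, §11 ("Using the Pincherle derivative identity …"), p. 728]
[cite: Robert2000PadicAnalysis, Ch. IV §5.5 Lemma, p. 203] -/
theorem diffOp_X_sub_one_pow_succ_X_mul_sub (m : ℕ) (f : K[X]) :
    diffOp ((PowerSeries.X - 1) ^ (m + 1)) (X * f) - X * diffOp ((PowerSeries.X - 1) ^ (m + 1)) f =
      ((m + 1 : ℕ) : K) • diffOp ((PowerSeries.X - 1 : PowerSeries K) ^ m) f := by
  rw [diffOp_X_mul_sub, PowerSeries.derivative_pow, Nat.add_sub_cancel, map_sub,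
    PowerSeries.derivative_X, Derivation.map_one_eq_zero, sub_zero, mul_one,
    show ((m + 1 : ℕ) : PowerSeries K) * (PowerSeries.X - 1) ^ m =
      ((m + 1 : ℕ) : K) • (PowerSeries.X - 1) ^ m by rw [← nsmul_eq_mul, Nat.cast_smul_eq_nsmul],
    diffOp_smul, LinearMap.smul_apply]

variable [CharZero K]

/-- **The Laguerre operator is a delta operator.** [cite: RotaKahanerOdlyzko1973, §11, p. 727]
[cite: Robert2000PadicAnalysis, Ch. IV §5.5 Proposition, p. 203] -/
theorem isDeltaOperator_laguerreOperator : IsDeltaOperator (laguerreOperator K) :=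
  isDeltaOperator_derivative_comp_diffOp (constantCoeff_X_sub_one_inv_ne_zero K)

/-- `K = D/(D − I)` is the composition operator `(t (t − 1)^{−1})(D)`.
[cite: RotaKahanerOdlyzko1973, §11, p. 727] -/
theorem laguerreOperator_eq_diffOp :
    laguerreOperator K = diffOp (PowerSeries.X * (PowerSeries.X - 1 : PowerSeries K)⁻¹) := by
  rw [laguerreOperator_eq, derivative_comp_diffOp_eq]

variable {K} in
/-- **`K = −D − D² − D³ − ⋯`**: on a polynomial of degree `< N`,
`K f = −(D f + D² f + ⋯ + D^N f)`. [cite: RotaKahanerOdlyzko1973, §11, p. 727] -/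
theorem laguerreOperator_apply (f : K[X]) {N : ℕ} (hN : f.natDegree < N) :
    laguerreOperator K f = -∑ k ∈ range N, derivative^[k + 1] f := by
  rw [laguerreOperator_eq_diffOp, diffOp_apply _ f (show f.natDegree < N + 1 by omega),
    sum_range_succ', coeff_X_mul_X_sub_one_inv K 0, if_pos rfl, zero_smul, add_zero,
    ← sum_neg_distrib]
  refine sum_congr rfl fun k _ => ?_
  rw [coeff_X_mul_X_sub_one_inv, if_neg (Nat.succ_ne_zero k), neg_one_smul]

/-! ## The basic Laguerre polynomials `L_n` -/

/-- **The basic Laguerre polynomials** `L_n` — the basic sequence of the Laguerre operator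
`K = D/(D − I)`. [cite: RotaKahanerOdlyzko1973, §11 (*), p. 727] -/
def laguerreBasic (n : ℕ) : K[X] :=
  (isDeltaOperator_laguerreOperator K).basicSequence n

/-- `(L_n)_n` is the basic sequence of `K = D/(D − I)`.
[cite: RotaKahanerOdlyzko1973, §11 (*), p. 727] -/
theorem isBasicSequence_laguerreBasic : IsBasicSequence (laguerreOperator K) (laguerreBasic K) :=
  (isDeltaOperator_laguerreOperator K).isBasicSequence_basicSequence

/-- `L_0 = 1`. [cite: RotaKahanerOdlyzko1973, §11, p. 727] -/
theorem laguerreBasic_zero : laguerreBasic K 0 = 1 :=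
  (isBasicSequence_laguerreBasic K).apply_zero

/-- `deg L_n = n`. [cite: RotaKahanerOdlyzko1973, §11, p. 727] -/
theorem natDegree_laguerreBasic (n : ℕ) : (laguerreBasic K n).natDegree = n :=
  (isBasicSequence_laguerreBasic K).natDegree_eq n

/-- `L_n (0) = 0` for `n ≥ 1`. [cite: RotaKahanerOdlyzko1973, §11, p. 727] -/
theorem laguerreBasic_eval_zero {n : ℕ} (hn : n ≠ 0) : (laguerreBasic K n).eval 0 = 0 :=
  (isBasicSequence_laguerreBasic K).eval_zero hn

/-- `K L_{n+1} = (n+1) L_n`. [cite: RotaKahanerOdlyzko1973, §11, p. 727] -/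
theorem laguerreOperator_laguerreBasic_succ (n : ℕ) :
    laguerreOperator K (laguerreBasic K (n + 1)) = ((n + 1 : ℕ) : K) • laguerreBasic K n :=
  (isBasicSequence_laguerreBasic K).map_succ n

/-- **(*) via the transfer formula** `p_n = x P^{−n} x^{n−1}` (Theorem 4 (3)) with
`P^{−n} = (t − 1)^n (D)`: `L_n = x · ((t − 1)^n)(D) x^{n−1}` (`n ≥ 1`).
[cite: RotaKahanerOdlyzko1973, §11 (*) and §4 Theorem 4 (3), pp. 727, 695]
[cite: Robert2000PadicAnalysis, Ch. IV §5.5 Proposition, p. 203] -/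
theorem laguerreBasic_eq_X_mul_diffOp {n : ℕ} (hn : n ≠ 0) :
    laguerreBasic K n = X * diffOp ((PowerSeries.X - 1) ^ n) (X ^ (n - 1)) := by
  have h := basicSequence_derivative_comp_diffOp_eq_X_mul (constantCoeff_X_sub_one_inv_ne_zero K) hn
  rw [X_sub_one_inv_inv] at h
  exact h

/-- **Rota–Kahaner–Odlyzko (*): `L_n (x) = x (D − I)^n x^{n−1}`** (`n ≥ 1`), "easily computed
from Theorem 4, formula (3)". [cite: RotaKahanerOdlyzko1973, §11 (*), p. 727]
[cite: Robert2000PadicAnalysis, Ch. IV §5.5 Proposition, p. 203] -/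
theorem laguerreBasic_eq {n : ℕ} (hn : n ≠ 0) :
    laguerreBasic K n = X * ((derivative - LinearMap.id : K[X] →ₗ[K] K[X]) ^ n) (X ^ (n - 1)) := by
  rw [laguerreBasic_eq_X_mul_diffOp K hn, diffOp_pow, diffOp_sub, diffOp_X, diffOp_one]

/-- **`L_{m+1} = −(D − I)^m x^{m+1}`** — from (*) by the Pincherle derivative identity (the case
`α = −1` of "`L_n^{(α)} = (−1)^n (I − D)^{α+n} x^n`").
[cite: RotaKahanerOdlyzko1973, §11, p. 728] -/
theorem laguerreBasic_succ_eq_neg (m : ℕ) :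
    laguerreBasic K (m + 1) = -diffOp ((PowerSeries.X - 1) ^ m) (X ^ (m + 1)) := by
  have hP := diffOp_X_sub_one_pow_succ_X_mul_sub m (X ^ m : K[X])
  rw [← pow_succ'] at hP
  have hB : X * diffOp ((PowerSeries.X - 1) ^ (m + 1)) (X ^ m : K[X]) =
      diffOp ((PowerSeries.X - 1) ^ (m + 1)) (X ^ (m + 1)) -
        ((m + 1 : ℕ) : K) • diffOp ((PowerSeries.X - 1 : PowerSeries K) ^ m) (X ^ m) := by
    rw [← hP, sub_sub_cancel]
  rw [laguerreBasic_eq_X_mul_diffOp K (Nat.add_one_ne_zero m), Nat.add_sub_cancel, hB,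
    pow_succ (PowerSeries.X - 1 : PowerSeries K) m, diffOp_mul, LinearMap.comp_apply, diffOp_sub,
    diffOp_X, diffOp_one, LinearMap.sub_apply, LinearMap.id_apply, derivative_X_pow,
    Nat.add_sub_cancel, C_mul', map_sub, map_smul, sub_sub_cancel_left]

/-- **`L_n = (−1)^n (I − D)^{n−1} x^n`** (all `n`; for `n = 0` both sides are `1`).
[cite: RotaKahanerOdlyzko1973, §11 ("`L_n^{(α)} (x) = (−1)^n (I − D)^{α+n} x^n`", `α = −1`), p. 728] -/
theorem laguerreBasic_eq_smul_diffOp_one_sub_X_pow (n : ℕ) :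
    laguerreBasic K n = (-1 : K) ^ n • diffOp ((1 - PowerSeries.X) ^ (n - 1)) (X ^ n) := by
  rcases n with _ | m
  · rw [laguerreBasic_zero, pow_zero, one_smul, Nat.zero_sub, pow_zero, pow_zero, diffOp_one,
      LinearMap.id_apply]
  · have h1 : (-(PowerSeries.X - 1) : PowerSeries K) ^ m = ((-1 : K) ^ m) • (PowerSeries.X - 1) ^ m := by
      rw [neg_pow, PowerSeries.smul_eq_C_mul, map_pow, map_neg, map_one]
    rw [laguerreBasic_succ_eq_neg, Nat.add_sub_cancel, ← neg_sub PowerSeries.X (1 : PowerSeries K), h1,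
      diffOp_smul, LinearMap.smul_apply, smul_smul, ← pow_add, show m + 1 + m = 2 * m + 1 by omega,
      pow_succ (-1 : K) (2 * m), pow_mul, neg_one_sq, one_pow, one_mul, neg_one_smul]

/-- **The Lah-number expansion**: `L_n (x) = Σ_{k=1}^{n} n!/k! · C(n−1, k−1) (−x)^k` — "the
coefficients `n!/k! · C(n−1, k−1)` are known as the (signless) Lah numbers" (`n ≥ 1`; the sum is
written over `k − 1 < n`). [cite: RotaKahanerOdlyzko1973, §11, p. 727] -/
theorem laguerreBasic_eq_sum_lah {n : ℕ} (hn : n ≠ 0) :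
    laguerreBasic K n = ∑ k ∈ range n,
      ((n.factorial : K) / ((k + 1).factorial : K) * ((n - 1).choose k : K)) • (-X) ^ (k + 1) := by
  obtain ⟨m, rfl⟩ := Nat.exists_eq_add_one_of_ne_zero hn
  rw [laguerreBasic_eq_X_mul_diffOp K hn, Nat.add_sub_cancel, diffOp_apply_X_pow, mul_sum]
  conv_lhs => rw [← sum_range_reflect]
  refine sum_congr rfl fun k hk => ?_
  have hkm : k ≤ m := Nat.lt_succ_iff.1 (mem_range.1 hk)
  have hc : (m + 1).choose (m - k) = (m + 1).choose (k + 1) := by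
    rw [show m - k = (m + 1) - (k + 1) by omega, Nat.choose_symm (by omega)]
  have natkey : (m + 1).choose (k + 1) * m.descFactorial (m - k) * (k + 1).factorial =
      (m + 1).factorial * m.choose k := by
    have h1 : (m + 1) * m.choose k = (m + 1).choose (k + 1) * (k + 1) := Nat.add_one_mul_choose_eq m k
    have h2 : k.factorial * m.descFactorial (m - k) = m.factorial := by
      have := Nat.factorial_mul_descFactorial (Nat.sub_le m k)
      rwa [Nat.sub_sub_self hkm] at this
    calc (m + 1).choose (k + 1) * m.descFactorial (m - k) * (k + 1).factorial
        = ((m + 1).choose (k + 1) * (k + 1)) * (k.factorial * m.descFactorial (m - k)) := by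
          rw [Nat.factorial_succ]; ring
      _ = ((m + 1) * m.choose k) * m.factorial := by rw [h1, h2]
      _ = (m + 1).factorial * m.choose k := by rw [Nat.factorial_succ]; ring
  have key : (((m + 1).choose (k + 1) : ℕ) : K) * (m.descFactorial (m - k) : K) =
      ((m + 1).factorial : K) / ((k + 1).factorial : K) * (m.choose k : K) := by
    rw [div_mul_eq_mul_div, eq_div_iff (Nat.cast_ne_zero.2 (Nat.factorial_ne_zero _))]
    exact_mod_cast natkey
  have hX : (-X : K[X]) ^ (k + 1) = ((-1 : K) ^ (k + 1)) • X ^ (k + 1) := by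
    rw [neg_pow, smul_eq_C_mul, map_pow, map_neg, map_one]
  rw [Nat.add_sub_cancel, Nat.sub_sub_self hkm, powerSeries_coeff_X_sub_one_pow, hc,
    show m + 1 - (m - k) = k + 1 by omega, mul_smul_comm, ← pow_succ', hX, smul_smul]
  congr 1
  rw [mul_assoc, key]
  ring

/-- `L_1 = −x`. [cite: RotaKahanerOdlyzko1973, §11, p. 727] -/
theorem laguerreBasic_one : laguerreBasic K 1 = -X := by
  have h := laguerreBasic_succ_eq_neg K 0
  rw [pow_zero, diffOp_one, LinearMap.id_apply, zero_add, pow_one] at h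
  exact h

/-- `L_2 = x² − 2x`. [cite: RotaKahanerOdlyzko1973, §11, p. 727] -/
theorem laguerreBasic_two : laguerreBasic K 2 = X ^ 2 - 2 * X := by
  have h := laguerreBasic_succ_eq_neg K 1
  rw [pow_one, diffOp_sub, diffOp_X, diffOp_one, LinearMap.sub_apply, LinearMap.id_apply,
    show 1 + 1 = 2 from rfl, derivative_X_sq, map_ofNat] at h
  rw [h]
  ring

/-- `L_3 = −x³ + 6x² − 6x` (Lah numbers `L(3,1) = 6`, `L(3,2) = 6`, `L(3,3) = 1`).
[cite: RotaKahanerOdlyzko1973, §11, p. 727] -/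
theorem laguerreBasic_three : laguerreBasic K 3 = -X ^ 3 + 6 * X ^ 2 - 6 * X := by
  rw [laguerreBasic_eq_sum_lah K three_ne_zero]
  simp only [sum_range_succ, sum_range_zero, zero_add, show Nat.factorial 3 = 6 from rfl,
    show Nat.factorial 2 = 2 from rfl, show Nat.factorial 1 = 1 from rfl,
    show (3 : ℕ) - 1 = 2 from rfl, show Nat.choose 2 0 = 1 from rfl, show Nat.choose 2 1 = 2 from rfl,
    show Nat.choose 2 2 = 1 from rfl, Nat.cast_one, Nat.cast_ofNat, smul_eq_C_mul]
  norm_num [map_ofNat]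
  ring

/-- **The binomial identity for the basic Laguerre polynomials** (a sequence of binomial type):
`L_n (x + y) = Σ_k C(n,k) L_k (x) L_{n−k} (y)`.
[cite: RotaKahanerOdlyzko1973, §11, p. 729] [cite: RotaKahanerOdlyzko1973, §2 Theorem 1, p. 689] -/
theorem laguerreBasic_eval_add (n : ℕ) (x y : K) :
    (laguerreBasic K n).eval (x + y) =
      ∑ k ∈ range (n + 1), (n.choose k : K) * (laguerreBasic K k).eval x *
        (laguerreBasic K (n - k)).eval y :=
  (isBasicSequence_laguerreBasic K).eval_add_self (isDeltaOperator_laguerreOperator K) n x y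

/-! ## The Laguerre polynomials of integral order `α = m − 1` -/

/-- **The Laguerre polynomials of order `α`** in the normalisation of Rota–Kahaner–Odlyzko
(`= n! ×` the classical ones), for integral `α = m − 1 ≥ −1`: the Sheffer set
`L_n^{(α)} = (I − D)^{α+1} L_n` of the Laguerre operator relative to the invertible operator
`(I − D)^{α+1}`; `m = 0` gives back the basic Laguerre polynomials (`α = −1`).
[cite: RotaKahanerOdlyzko1973, §11 ("`L_n^{(α)} (x) = (I − D)^{α+1} L_n (x)`"), p. 728] -/
def laguerreSheffer (m n : ℕ) : K[X] :=
  diffOp ((1 - PowerSeries.X) ^ m) (laguerreBasic K n)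

/-- Unfolding `L_n^{(m−1)} = (I − D)^m L_n`. [cite: RotaKahanerOdlyzko1973, §11, p. 728] -/
theorem laguerreSheffer_eq (m n : ℕ) :
    laguerreSheffer K m n = diffOp ((1 - PowerSeries.X) ^ m) (laguerreBasic K n) :=
  rfl

/-- `α = −1`: `L_n^{(−1)} = L_n` ("This is true even of the basic Laguerre polynomials, which
correspond to the case `α = −1`"). [cite: RotaKahanerOdlyzko1973, §11, pp. 728–729] -/
theorem laguerreSheffer_zero_left (n : ℕ) : laguerreSheffer K 0 n = laguerreBasic K n := by
  rw [laguerreSheffer_eq, pow_zero, diffOp_one, LinearMap.id_apply]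

/-- `L_0^{(α)} = 1`. [cite: RotaKahanerOdlyzko1973, §11, p. 728] -/
theorem laguerreSheffer_zero_right (m : ℕ) : laguerreSheffer K m 0 = 1 := by
  rw [laguerreSheffer_eq, laguerreBasic_zero, diffOp_one_sub_X_pow_apply_one]

/-- **`(L_n^{(α)})_n` is a Sheffer set for the Laguerre operator** ("the Sheffer sets relative to
these operators are polynomial sets `L_n^{(α)}`, classically known as Laguerre polynomials of order
`α`"). [cite: RotaKahanerOdlyzko1973, §11, p. 728]
[cite: RotaKahanerOdlyzko1973, §5 Proposition 1, p. 698] -/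
theorem isShefferSequence_laguerreSheffer (m : ℕ) :
    IsShefferSequence (laguerreOperator K) (laguerreSheffer K m) :=
  (isBasicSequence_laguerreBasic K).isShefferSequence_map (isDeltaOperator_laguerreOperator K)
    (isShiftInvariant_diffOp _) (by rw [diffOp_one_sub_X_pow_apply_one]; exact one_ne_zero)

/-- **`(I − D)^β L_n^{(α)} = L_n^{(α+β)}`**. [cite: RotaKahanerOdlyzko1973, §11, p. 728] -/
theorem diffOp_one_sub_X_pow_laguerreSheffer (b m n : ℕ) :
    diffOp ((1 - PowerSeries.X) ^ b) (laguerreSheffer K m n) = laguerreSheffer K (b + m) n := by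
  rw [laguerreSheffer_eq, laguerreSheffer_eq, ← LinearMap.comp_apply, ← diffOp_mul, ← pow_add]

/-- **The Rodrigues-type formula `L_n^{(α)} = (−1)^n (I − D)^{α+n} x^n`** (here `α + n =
m + n − 1`). [cite: RotaKahanerOdlyzko1973, §11, p. 728] -/
theorem laguerreSheffer_eq_smul_diffOp (m n : ℕ) :
    laguerreSheffer K m n = (-1 : K) ^ n • diffOp ((1 - PowerSeries.X) ^ (m + n - 1)) (X ^ n) := by
  rcases n with _ | k
  · rw [laguerreSheffer_zero_right, pow_zero, one_smul, pow_zero, diffOp_one_sub_X_pow_apply_one]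
  · rw [laguerreSheffer_eq, laguerreBasic_eq_smul_diffOp_one_sub_X_pow, Nat.add_sub_cancel, map_smul,
      ← LinearMap.comp_apply, ← diffOp_mul, ← pow_add, show m + (k + 1) - 1 = m + k by omega]

/-- **The coefficients of the Laguerre polynomials**: expanding `(−1)^n Σ_k (−1)^k C(α+n, k) D^k x^n`
gives `L_n^{(α)} (x) = Σ_{k=0}^{n} (−1)^k C(n+α, n−k) · n!/k! · x^k` (`α = m − 1`).
[cite: RotaKahanerOdlyzko1973, §11, p. 728] -/
theorem laguerreSheffer_eq_sum (m n : ℕ) :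
    laguerreSheffer K m n = ∑ k ∈ range (n + 1),
      ((-1 : K) ^ k * ((m + n - 1).choose (n - k) : K) * ((n.factorial : K) / (k.factorial : K))) •
        X ^ k := by
  rw [laguerreSheffer_eq_smul_diffOp, diffOp_apply_X_pow, smul_sum]
  conv_lhs => rw [← sum_range_reflect]
  refine sum_congr rfl fun k hk => ?_
  have hkn : k ≤ n := Nat.lt_succ_iff.1 (mem_range.1 hk)
  have hdf : (n.descFactorial (n - k) : K) = (n.factorial : K) / (k.factorial : K) := by
    rw [eq_div_iff (Nat.cast_ne_zero.2 (Nat.factorial_ne_zero k))]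
    have h := Nat.factorial_mul_descFactorial (Nat.sub_le n k)
    rw [Nat.sub_sub_self hkn, mul_comm] at h
    exact_mod_cast h
  have hs : (-1 : K) ^ n * (-1) ^ (n - k) = (-1) ^ k := by
    rw [← pow_add, show n + (n - k) = k + 2 * (n - k) by omega, pow_add, pow_mul, neg_one_sq, one_pow,
      mul_one]
  rw [Nat.add_sub_cancel, Nat.sub_sub_self hkn, powerSeries_coeff_one_sub_X_pow, smul_smul, hdf]
  congr 1
  calc (-1 : K) ^ n * ((-1) ^ (n - k) * (((m + n - 1).choose (n - k) : ℕ) : K) *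
        ((n.factorial : K) / (k.factorial : K)))
      = ((-1 : K) ^ n * (-1) ^ (n - k)) * ((m + n - 1).choose (n - k) : K) *
        ((n.factorial : K) / (k.factorial : K)) := by ring
    _ = _ := by rw [hs]

/-- `L_1^{(α)} = (α + 1) − x`, i.e. `L_1^{(m−1)} = m − x`. [cite: RotaKahanerOdlyzko1973, §11, p. 728] -/
theorem laguerreSheffer_one_right (m : ℕ) : laguerreSheffer K m 1 = C (m : K) - X := by
  rw [laguerreSheffer_eq, laguerreBasic_one, map_neg, diffOp_apply_X, map_pow, map_sub, map_one,
    PowerSeries.constantCoeff_X, sub_zero, one_pow, one_smul, powerSeries_coeff_one_sub_X_pow, pow_one,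
    Nat.choose_one_right, neg_add, ← C_neg, neg_mul, neg_neg, one_mul]
  ring

/-- **The binomial theorem for the Laguerre polynomials** (Proposition 2 of §5 applied to the
Sheffer set `L^{(α)}`): `L_n^{(α)} (x + y) = Σ_k C(n,k) L_k (x) L_{n−k}^{(α)} (y)`.
[cite: RotaKahanerOdlyzko1973, §11, p. 729] [cite: RotaKahanerOdlyzko1973, §5 Proposition 2, p. 701] -/
theorem laguerreSheffer_eval_add (m n : ℕ) (x y : K) :
    (laguerreSheffer K m n).eval (x + y) =
      ∑ k ∈ range (n + 1), (n.choose k : K) * (laguerreBasic K k).eval x *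
        (laguerreSheffer K m (n - k)).eval y :=
  (isShefferSequence_laguerreSheffer K m).eval_add (isDeltaOperator_laguerreOperator K)
    (isBasicSequence_laguerreBasic K) n x y

/-- **The first composition law**: applying `(I − D)^{β+1}` (in `x`) to the binomial theorem,
`L_n^{(α+β+1)} (x + y) = Σ_k C(n,k) L_k^{(β)} (x) L_{n−k}^{(α)} (y)` (orders `α = a − 1`,
`β = b − 1`, `α + β + 1 = (b + a) − 1`). [cite: RotaKahanerOdlyzko1973, §11, p. 729] -/
theorem laguerreSheffer_add_eval_add (a b n : ℕ) (x y : K) :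
    (laguerreSheffer K (b + a) n).eval (x + y) =
      ∑ k ∈ range (n + 1), (n.choose k : K) * (laguerreSheffer K b k).eval x *
        (laguerreSheffer K a (n - k)).eval y := by
  have hδ := isDeltaOperator_laguerreOperator K
  have hp := isBasicSequence_laguerreBasic K
  have hs := isShefferSequence_laguerreSheffer K a
  have hS : IsShiftInvariant (diffOp ((1 - PowerSeries.X : PowerSeries K) ^ b)) :=
    isShiftInvariant_diffOp _
  have ht := hp.taylor_eq_sum hδ (laguerreSheffer K a n) y
    (show (laguerreSheffer K a n).natDegree < n + 1 by rw [hs.natDegree_eq]; exact lt_add_one n)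
  have h := congrArg (fun g => (diffOp ((1 - PowerSeries.X : PowerSeries K) ^ b) g).eval x) ht
  rw [hS y, diffOp_one_sub_X_pow_laguerreSheffer, taylor_eval, map_sum, eval_finsetSum] at h
  rw [h]
  refine sum_congr rfl fun k hk => ?_
  have hkn : k ≤ n := Nat.lt_succ_iff.1 (mem_range.1 hk)
  have hk0 : (k.factorial : K) ≠ 0 := Nat.cast_ne_zero.2 (Nat.factorial_ne_zero k)
  rw [map_smul, eval_smul, smul_eq_mul, ← laguerreSheffer_eq, hs.pow_apply_of_le hkn, eval_smul,
    smul_eq_mul, Nat.descFactorial_eq_factorial_mul_choose, Nat.cast_mul, mul_assoc,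
    mul_div_cancel_left₀ _ hk0]
  ring

end Literature.Algebra.Polynomial
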